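import Mathlib.FieldTheory.Finite.GaloisField
import Mathlib.FieldTheory.IsAlgClosed.AlgebraicClosure
import Mathlib.FieldTheory.Perfect
import Mathlib.RingTheory.Polynomial.UniqueFactorization
import Literature.RingTheory.MvPolynomial.KaltofenNoetherFormsProofs

/-!
# LangWeilTransfer, support item `GoodReduction` (stmt-ValiantsHypothesis-6377) — Frobenius
# descent of an absolute factor to a small Galois field

Helper for the general case of `GoodReduction` (route `LangWeilTransfer` of `ValiantsHypothesis`):
if `Q ∈ ℤ[x_0..x_m]` is, modulo `p`, a non-zero non-unit, and every family of pairwise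
non-associated irreducible factors of `Q` over `𝔽̄_p = AlgebraicClosure (ZMod p)` has at most `g`
members, then `Q mod p` has an absolutely irreducible factor defined over `GaloisField p e` for
some `1 ≤ e ≤ g`: the Frobenius orbit (up to association) of any irreducible factor `R` has length
`e ≤ g`, so a normalisation of `R` has coefficients fixed by `x ↦ x^(p^e)`, i.e. in the image of
`GaloisField p e`; irreducibility over an algebraic closure and the divisibility descend.
Elementary Galois descent for finite fields; no new definitions. Honest framing: bookkeeping for a
dormant conditional route; nothing here bears on VP ≠ VNP.
-/

noncomputable section

open MvPolynomial

-- the summit and the problem share the name `ValiantsHypothesis` (D-0017 single-conjunct layout)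
set_option linter.dupNamespace false

namespace Summit.ValiantsHypothesis.ValiantsHypothesis.Theorems.LangWeilTransfer

open Literature.RingTheory.MvPolynomial (irreducible_map_of_isAlgClosed irreducible_of_irreducible_map)

variable {σ : Type*}

/-- Elements of an algebraically closed field of characteristic `p` fixed by `x ↦ x^(p^e)`
(`e ≠ 0`) come from `GaloisField p e` along any embedding `j`. -/
theorem mem_range_of_pow_eq (p : ℕ) [Fact p.Prime] {e : ℕ} (he : e ≠ 0)
    {L : Type*} [Field L] [Algebra (ZMod p) L] (j : GaloisField p e →ₐ[ZMod p] L)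
    {x : L} (hx : x ^ p ^ e = x) : x ∈ Set.range j := by
  classical
  haveI : Fintype (GaloisField p e) := Fintype.ofFinite _
  have hcard : Fintype.card (GaloisField p e) = p ^ e := by
    rw [← Nat.card_eq_fintype_card, GaloisField.card p e he]
  have hp : 1 < p := (Fact.out : p.Prime).one_lt
  have hP0 : (Polynomial.X ^ p ^ e - Polynomial.X : Polynomial L) ≠ 0 :=
    FiniteField.X_pow_card_pow_sub_X_ne_zero L he hp
  have hPdeg : (Polynomial.X ^ p ^ e - Polynomial.X : Polynomial L).natDegree = p ^ e :=
    FiniteField.X_pow_card_pow_sub_X_natDegree_eq L he hp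
  have hroot : ∀ y : L, y ∈ (Polynomial.X ^ p ^ e - Polynomial.X : Polynomial L).roots.toFinset ↔
      y ^ p ^ e = y := by
    intro y
    rw [Multiset.mem_toFinset, Polynomial.mem_roots hP0, Polynomial.IsRoot, Polynomial.eval_sub,
      Polynomial.eval_pow, Polynomial.eval_X, sub_eq_zero]
  -- the image of `j` consists of roots
  set T : Finset L := Finset.univ.image (fun z => j z) with hT
  have hTcard : T.card = p ^ e := by
    have hinj : Function.Injective (fun z : GaloisField p e => j z) := fun a b h => j.toRingHom.injective h
    rw [hT, Finset.card_image_of_injective _ hinj, Finset.card_univ, hcard]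
  have hTroots : T ⊆ (Polynomial.X ^ p ^ e - Polynomial.X : Polynomial L).roots.toFinset := by
    intro y hy
    rw [hT, Finset.mem_image] at hy
    obtain ⟨z, -, rfl⟩ := hy
    rw [hroot, ← map_pow]
    congr 1
    rw [← hcard]; exact FiniteField.pow_card z
  have hle : (Polynomial.X ^ p ^ e - Polynomial.X : Polynomial L).roots.toFinset.card ≤ T.card := by
    have h1 := Polynomial.card_roots' (Polynomial.X ^ p ^ e - Polynomial.X : Polynomial L)
    rw [hPdeg] at h1
    rw [hTcard]
    exact (Multiset.toFinset_card_le _).trans h1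
  have heq : T = (Polynomial.X ^ p ^ e - Polynomial.X : Polynomial L).roots.toFinset :=
    Finset.eq_of_subset_of_card_le hTroots hle
  have hxroot : x ∈ (Polynomial.X ^ p ^ e - Polynomial.X : Polynomial L).roots.toFinset :=
    (hroot x).mpr hx
  rw [← heq, hT, Finset.mem_image] at hxroot
  obtain ⟨z, -, hz⟩ := hxroot
  exact ⟨z, hz⟩

/-- A polynomial all of whose coefficients lie in the image of an injective ring map is the image
of a polynomial. -/
theorem exists_map_eq_of_coeff_mem_range {R S : Type*} [CommRing R] [CommRing S] (j : R →+* S)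
    {P : MvPolynomial σ S} (h : ∀ m, P.coeff m ∈ Set.range j) :
    ∃ P₀ : MvPolynomial σ R, MvPolynomial.map j P₀ = P := by
  classical
  choose c hc using h
  refine ⟨∑ m ∈ P.support, monomial m (c m), ?_⟩
  rw [map_sum]
  simp only [MvPolynomial.map_monomial, hc]
  exact (MvPolynomial.as_sum P).symm

/-- **Frobenius descent of an absolute factor.** Let `p` be prime, `L = 𝔽̄_p`, `Q ∈ ℤ[x_σ]` with
`Q mod p` a non-zero non-unit, and suppose every family of pairwise non-associated irreducible
factors of `Q` over `L` has at most `g` members. Then for some `1 ≤ e ≤ g` there is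
`Q₁ ∈ GaloisField p e [x_σ]`, irreducible over the algebraic closure of `GaloisField p e`, with
`Q₁ ∣ Q` over `GaloisField p e`. -/
theorem exists_absIrreducible_factor_galoisField [Fintype σ] (p : ℕ) [Fact p.Prime]
    (Q : MvPolynomial σ ℤ) {g : ℕ}
    (hQ0 : MvPolynomial.map (Int.castRingHom (ZMod p)) Q ≠ 0)
    (hQu : ¬ IsUnit (MvPolynomial.map (Int.castRingHom (ZMod p)) Q))
    (hbound : ∀ (r : ℕ) (w : Fin r → MvPolynomial σ (AlgebraicClosure (ZMod p))),
      (∀ i, Irreducible (w i)) → (∀ i k, i ≠ k → ¬ w i ∣ w k) →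
      (∀ i, w i ∣ MvPolynomial.map (Int.castRingHom (AlgebraicClosure (ZMod p))) Q) → r ≤ g) :
    ∃ e : ℕ, 0 < e ∧ e ≤ g ∧ ∃ Q₁ : MvPolynomial σ (GaloisField p e),
      Irreducible (MvPolynomial.map (algebraMap (GaloisField p e) (AlgebraicClosure (GaloisField p e))) Q₁) ∧
      Q₁ ∣ MvPolynomial.map (algebraMap ℤ (GaloisField p e)) Q := by
  classical
  set L := AlgebraicClosure (ZMod p) with hL
  haveI : CharP L p := charP_of_injective_algebraMap (algebraMap (ZMod p) L).injective p
  haveI : ExpChar L p := ExpChar.prime Fact.out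
  haveI : PerfectRing L p := PerfectField.toPerfectRing p
  -- `Q` over `L`
  set QL := MvPolynomial.map (Int.castRingHom L) Q with hQL
  have hcastL : (algebraMap (ZMod p) L).comp (Int.castRingHom (ZMod p)) = Int.castRingHom L :=
    RingHom.ext_int _ _
  have hQL' : QL = MvPolynomial.map (algebraMap (ZMod p) L) (MvPolynomial.map (Int.castRingHom (ZMod p)) Q) := by
    rw [hQL, MvPolynomial.map_map, hcastL]
  have hQL0 : QL ≠ 0 := by
    rw [hQL']; exact (map_ne_zero_iff _ (MvPolynomial.map_injective _ (algebraMap (ZMod p) L).injective)).mpr hQ0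
  have hQLu : ¬ IsUnit QL := fun hu =>
    hQu (Literature.RingTheory.MvPolynomial.isUnit_of_isUnit_map (algebraMap (ZMod p) L) (by rw [← hQL']; exact hu))
  -- an irreducible factor `R` and its Frobenius translates
  obtain ⟨R, hR, hRQ⟩ := WfDvdMonoid.exists_irreducible_factor hQLu hQL0
  set σe : ℕ → (L ≃+* L) := fun i => iterateFrobeniusEquiv L p i with hσe
  have hσQL : ∀ i, MvPolynomial.map (σe i : L →+* L) QL = QL := by
    intro i
    rw [hQL, MvPolynomial.map_map,
      RingHom.ext_int ((σe i : L →+* L).comp (Int.castRingHom L)) (Int.castRingHom L)]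
  set Rt : ℕ → MvPolynomial σ L := fun i => MvPolynomial.map (σe i : L →+* L) R with hRt
  have hRt_irr : ∀ i, Irreducible (Rt i) := fun i =>
    (MulEquiv.irreducible_iff (MvPolynomial.mapEquiv σ (σe i))).mpr hR
  have hRt_dvd : ∀ i, Rt i ∣ QL := fun i => by
    rw [← hσQL i]; exact map_dvd _ hRQ
  have hcomp : ∀ i k, ((σe i : L →+* L).comp (σe k : L →+* L)) = (σe (i + k) : L →+* L) :=
    fun i k => RingHom.ext fun x => by
      show σe i (σe k x) = σe (i + k) x
      simp only [hσe, iterateFrobeniusEquiv_def]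
      ring
  have hRt_add : ∀ i k, Rt (i + k) = MvPolynomial.map (σe i : L →+* L) (Rt k) := by
    intro i k
    show MvPolynomial.map _ R = MvPolynomial.map _ (MvPolynomial.map _ R)
    rw [MvPolynomial.map_map, hcomp]
  have hid : (σe 0 : L →+* L) = RingHom.id L :=
    RingHom.ext fun x => by
      show σe 0 x = x
      simp only [hσe, iterateFrobeniusEquiv_def, pow_zero, pow_one]
  have hRt0 : Rt 0 = R := by
    show MvPolynomial.map _ R = R
    rw [hid, MvPolynomial.map_id]
  have hsymm : ∀ i, ((σe i).symm : L →+* L).comp (σe i : L →+* L) = RingHom.id L :=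
    fun i => RingHom.ext fun x => by simp
  have hcancel : ∀ (i : ℕ) (A B : MvPolynomial σ L),
      MvPolynomial.map (σe i : L →+* L) A ∣ MvPolynomial.map (σe i : L →+* L) B → A ∣ B := by
    intro i A B h
    have h2 := map_dvd (MvPolynomial.map ((σe i).symm : L →+* L)) h
    rwa [MvPolynomial.map_map, MvPolynomial.map_map, hsymm i, MvPolynomial.map_id,
      MvPolynomial.map_id] at h2
  -- pigeonhole: two translates among `Rt 0, …, Rt g` are associated
  obtain ⟨e, he1, heg, hdiv⟩ : ∃ e, 1 ≤ e ∧ e ≤ g ∧ R ∣ Rt e := by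
    by_contra hno
    push Not at hno
    have hna : ∀ i k : Fin (g + 1), i ≠ k → ¬ Rt i ∣ Rt k := by
      intro i k hik hd
      rcases lt_or_gt_of_ne (Fin.val_ne_of_ne hik) with hlt | hgt
      · -- `Rt i ∣ Rt k = σ^i (Rt (k - i))` gives `R ∣ Rt (k - i)`
        have hk : (k : ℕ) = i + (k - i) := by omega
        have h1 : R ∣ Rt (k - i) := by
          refine hcancel i R (Rt (k - i)) ?_
          have e1 : MvPolynomial.map (σe i : L →+* L) R = Rt i := rfl
          have e2 : MvPolynomial.map (σe i : L →+* L) (Rt (k - i)) = Rt k := by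
            rw [← hRt_add, ← hk]
          rw [e1, e2]; exact hd
        exact hno (k - i) (by omega) (by omega) h1
      · have hi : (i : ℕ) = k + (i - k) := by omega
        have h1 : Rt (i - k) ∣ R := by
          refine hcancel k (Rt (i - k)) R ?_
          have e1 : MvPolynomial.map (σe k : L →+* L) R = Rt k := rfl
          have e2 : MvPolynomial.map (σe k : L →+* L) (Rt (i - k)) = Rt i := by
            rw [← hRt_add, ← hi]
          rw [e1, e2]; exact hd
        exact hno (i - k) (by omega) (by omega) ((hRt_irr _).dvd_symm hR h1)
    have := hbound (g + 1) (fun i => Rt i) (fun i => hRt_irr i) hna (fun i => hRt_dvd i)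
    omega
  -- normalise `R` so that the translate by `σ^e` FIXES it
  obtain ⟨t, ht⟩ := hdiv
  have htu : IsUnit t := (((hRt_irr e)).isUnit_or_isUnit ht).resolve_left hR.not_isUnit
  rw [MvPolynomial.isUnit_iff_totalDegree_of_isReduced] at htu
  obtain ⟨u, hu⟩ : ∃ u, t = MvPolynomial.C u := ⟨_, (totalDegree_eq_zero_iff_eq_C).mp htu.2⟩
  obtain ⟨a, ha⟩ := MvPolynomial.ne_zero_iff.mp hR.ne_zero
  set R' := MvPolynomial.C (R.coeff a)⁻¹ * R with hR'
  have hcoeffRt : ∀ b, (Rt e).coeff b = σe e (R.coeff b) := fun b => by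
    show (MvPolynomial.map _ R).coeff b = _
    rw [MvPolynomial.coeff_map]; rfl
  have hfix : ∀ b, σe e (R'.coeff b) = R'.coeff b := by
    intro b
    -- from `σ^e R = u R`: at `a`, `σ^e(r_a) = u r_a`
    have hb : σe e (R.coeff b) = u * R.coeff b := by
      rw [← hcoeffRt, ht, hu, mul_comm, MvPolynomial.coeff_C_mul]
    have haa : σe e (R.coeff a) = u * R.coeff a := by
      rw [← hcoeffRt, ht, hu, mul_comm, MvPolynomial.coeff_C_mul]
    have hu0 : u ≠ 0 := by
      intro hu0
      rw [hu, hu0, MvPolynomial.C_0, mul_zero] at ht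
      exact (hRt_irr e).ne_zero ht
    rw [hR', MvPolynomial.coeff_C_mul, map_mul, map_inv₀, hb, haa]
    calc (u * R.coeff a)⁻¹ * (u * R.coeff b) = (u⁻¹ * u) * ((R.coeff a)⁻¹ * R.coeff b) := by
          rw [mul_inv]; ring
      _ = (R.coeff a)⁻¹ * R.coeff b := by rw [inv_mul_cancel₀ hu0, one_mul]
  -- hence `R'` comes from `GaloisField p e`
  haveI : Fintype (GaloisField p e) := Fintype.ofFinite _
  let j : GaloisField p e →ₐ[ZMod p] L := IsAlgClosed.lift
  have hmem : ∀ b, R'.coeff b ∈ Set.range (j : GaloisField p e →+* L) := fun b =>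
    mem_range_of_pow_eq p (by omega) j (by rw [← iterateFrobeniusEquiv_def]; exact hfix b)
  obtain ⟨Q₁, hQ₁⟩ := exists_map_eq_of_coeff_mem_range (j : GaloisField p e →+* L) hmem
  have hR'irr : Irreducible R' := by
    rw [hR']
    exact (irreducible_isUnit_mul ((Ne.isUnit (inv_ne_zero ha)).map MvPolynomial.C)).mpr hR
  refine ⟨e, he1, heg, Q₁, ?_, ?_⟩
  · -- irreducibility over the algebraic closure of `GaloisField p e`
    letI : Algebra (GaloisField p e) L := (j : GaloisField p e →+* L).toAlgebra
    haveI : Algebra.IsAlgebraic (GaloisField p e) (AlgebraicClosure (GaloisField p e)) := inferInstance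
    let k : AlgebraicClosure (GaloisField p e) →ₐ[GaloisField p e] L := IsAlgClosed.lift
    have hk : (k : AlgebraicClosure (GaloisField p e) →+* L).comp (algebraMap (GaloisField p e) _) =
        (j : GaloisField p e →+* L) := k.comp_algebraMap
    refine irreducible_of_irreducible_map (k : AlgebraicClosure (GaloisField p e) →+* L) ?_
    rw [MvPolynomial.map_map, hk, hQ₁]
    exact hR'irr
  · -- divisibility descends: the cofactor is fixed by `σ^e` as well
    have hR'dvd : R' ∣ QL := by
      rw [hR']
      exact ((Ne.isUnit (inv_ne_zero ha)).map MvPolynomial.C).mul_left_dvd.mpr hRQ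
    obtain ⟨T, hT⟩ := hR'dvd
    have hR'0 : R' ≠ 0 := hR'irr.ne_zero
    have hσR' : MvPolynomial.map (σe e : L →+* L) R' = R' := by
      ext b; rw [MvPolynomial.coeff_map]; exact hfix b
    have hTfix : MvPolynomial.map (σe e : L →+* L) T = T := by
      have h1 := congrArg (MvPolynomial.map (σe e : L →+* L)) hT
      rw [hσQL, map_mul, hσR', hT] at h1
      exact (mul_left_cancel₀ hR'0 h1).symm
    have hTmem : ∀ b, T.coeff b ∈ Set.range (j : GaloisField p e →+* L) := fun b =>
      mem_range_of_pow_eq p (by omega) j (by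
        rw [← iterateFrobeniusEquiv_def]
        have := congrArg (MvPolynomial.coeff b) hTfix
        rwa [MvPolynomial.coeff_map] at this)
    obtain ⟨T₁, hT₁⟩ := exists_map_eq_of_coeff_mem_range (j : GaloisField p e →+* L) hTmem
    refine ⟨T₁, MvPolynomial.map_injective _ (j : GaloisField p e →+* L).injective ?_⟩
    have hj : (j : GaloisField p e →+* L).comp (algebraMap ℤ (GaloisField p e)) = Int.castRingHom L :=
      RingHom.ext_int _ _
    rw [map_mul, hQ₁, hT₁, ← hT, hQL, MvPolynomial.map_map, hj]

end Summit.ValiantsHypothesis.ValiantsHypothesis.Theorems.LangWeilTransfer
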